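import Literature.AlgebraicGeometry.Pohlmann1968.DegenerateCMTypesRibetLenstraSerre
import Literature.AlgebraicGeometry.ComplexMultiplication.SimpleIffPrimitiveCMType
import HarnessLib

/-!
# COR-CM: the CM types of `ℚ(ζ₇)` by residue sets — the six PRIMITIVE types are the translates of `{1,2,3}`,
# the two imprimitive ones are `{1,2,4}`, `{3,5,6}`; three column relations on the `6 × 6` incidence matrix

Cell `pub-hodgecm2` (COR-CM = stage 2 of the Hodge ladder), seat b27 (gen 21), count-neutral; part 1 of 2 of the
COMPLEMENT of the kernel census `CorCM/Census/DeligneWeilFamilyZeta7` (seat lit-deligne-3 gen 3), consumed by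
`CorCM/Zeta7PrimitiveWeilFamiliesDivisorial` (part 2: over `ℚ(ζ₇)` Deligne's Weil classes on products of SIMPLE CM
threefolds are divisor classes).  NEW as stated, hence under `Summits/`; everything PROVED (finite facts `decide`d on
`ℤ/7`), the only definitions are explicit finite data (`units7`, `prim7`, `conj6`) and the residue set `resSet Φ` of a
CM type; no named fact, no `sorry`.

SETTING.  `K = ℚ(ζ₇)` (any `L` with `IsCyclotomicExtension {7} ℚ L`), `Hom(K, ℂ) ≅ (ℤ/7)ˣ = {1,…,6}` by the exponent
`e(σ)`, `σ ζ₇ = e^{2πi e(σ)/7}` (the tree's `Pohlmann1968.Cyclotomic.expOf`; `Aut(ℂ)` acts through the cyclotomic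
character `autExp`, complex conjugation by `c ↦ −c`; L. C. Washington, *Introduction to Cyclotomic Fields*, Thm. 2.5).
A CM type `Φ` of `K` is recorded by its residue set `resSet Φ ⊆ (ℤ/7)ˣ` (§2: `mem_resSet_iff`, a set of
representatives of `(ℤ/7)ˣ/{±1}`, `resSet_cm`; equality and conjugacy of types are read on residue sets,
`carrier_eq_iff_resSet_eq`, `carrier_eq_compl_iff_resSet_eq`).

* §1 `prim7` — the six translates of `{1,2,3}` (`prim7_eq_translate`; conjugate pairs `prim7 (conj6 i) = −prim7 i`,
  `prim7_conj6`); **`separating_iff_mem_prim7`**: a CM residue set has SEPARATING translates (primitivity in Kubota's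
  form; G. Shimura, *Abelian Varieties with Complex Multiplication and Modular Functions*, §8.2 Prop. 26) iff it is
  one of the `prim7 i` — the other two CM residue sets are the cosets `{1,2,4}`, `{3,5,6}` of the subgroup of squares
  (`eq_squares_or_of_not_separating`), the types induced from `ℚ(√-7)`; **`primitive_colsum_symmetric`**: the three
  column relations `(col 1) − (col 3) = e₃ − e₂`, `(col 2) − (col 3) = e₁ − e₄`, `(col 1) − (col 5) = e₀ − e₅` of the
  incidence matrix "unit `c ∈ prim7 i`" force every multiplicity vector with CONSTANT incidence sums to be
  conjugation-symmetric (`n 0 = n 5`, `n 1 = n 4`, `n 2 = n 3`).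
* §2 **`isPrimitive_iff_resSet_separating`** — `(Φ, φ₀)` is primitive (the tree's `IsPrimitive` over `Aut(ℂ)`) iff the
  translates of `resSet Φ` separate the units (every unit is `autExp τ` for some `τ ∈ Aut(ℂ)`); hence
  `exists_prim7_eq_resSet_of_isPrimitive` / `_of_isSimple` (a SIMPLE realisation has type in `prim7`, Shimura §8.2
  Prop. 26 via the tree's `isSimple_iff_isPrimitive`) and `resSet_eq_squares_or_of_not_isSimple` (a NON-simple
  realisation has type `{1,2,4}` or `{3,5,6}`: `A ~ E³`, `E` an elliptic curve with CM by `ℚ(√-7)`).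

## References

* [Shimura1998] G. Shimura, *Abelian Varieties with Complex Multiplication and Modular Functions* (1998), §8.2
  Prop. 26.
* [Deligne1982HodgeCycles] P. Deligne, *Hodge cycles on abelian varieties*, LNM 900 (1982), I §5 (c), Lemma 5.2
  (re-edition pp. 38–40) — the constant-sum families whose multiplicities §1 constrains.
* [Washington1997] L. C. Washington, *Introduction to Cyclotomic Fields*, Thm. 2.5.
-/

noncomputable section

open CategoryTheory CategoryTheory.Limits NumberField

namespace Summit.HodgeConjecture.CorCM.Zeta7WeilFamily

open Literature.NumberTheory.ComplexMultiplication
open Literature.AlgebraicGeometry.Motives (AbelianVariety CMType)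
open Literature.AlgebraicGeometry.HodgeTheory
open Literature.AlgebraicGeometry.ComplexMultiplication (IsCMTypeRealisation isSimple_iff_isPrimitive)
open Literature.AlgebraicGeometry.Pohlmann1968
open Literature.AlgebraicGeometry.Pohlmann1968.Cyclotomic

/-! ### §1 Residues modulo `7`: the six primitive residue types and the three column relations -/

section Residues

/-- The units of `ℤ/7`, as a finite set: `{1, 2, 3, 4, 5, 6} ≅ Hom(ℚ(ζ₇), ℂ)` (the same set as
`Census.DeligneWeilFamilyZeta7.units7`). [cite: Washington1997, Thm. 2.5] -/
def units7 : Finset (ZMod 7) := {1, 2, 3, 4, 5, 6}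

/-- `c` is prime to `7` iff `c ∈ units7 = {1, …, 6}`. [cite: Washington1997, Thm. 2.5] -/
theorem coprime_seven_iff_mem_units7 (c : ZMod 7) : c.val.Coprime 7 ↔ c ∈ units7 := by
  revert c; decide

/-- **The six PRIMITIVE residue types of `ℚ(ζ₇)`** — the translates `{c | a·c ∈ {1,2,3}}`, `a ∈ (ℤ/7)ˣ`, of the type
`{1,2,3}`, listed as `{1,2,3}, {2,4,6}, {2,3,6}, {1,4,5}, {1,3,5}, {4,5,6}` (conjugate pairs `0 ↔ 5`, `1 ↔ 4`,
`2 ↔ 3`). [cite: Shimura1998, §8.2 Prop. 26] -/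
def prim7 : Fin 6 → Finset (ZMod 7) := ![{1, 2, 3}, {2, 4, 6}, {2, 3, 6}, {1, 4, 5}, {1, 3, 5}, {4, 5, 6}]

/-- The conjugation involution on the indices of `prim7`: `i ↦ 5 − i`. [folklore] -/
def conj6 (i : Fin 6) : Fin 6 := ⟨5 - i.val, by omega⟩

set_option maxRecDepth 8192 in
set_option synthInstance.maxSize 2048 in
set_option synthInstance.maxHeartbeats 200000 in
/-- **Classification of the primitive types of `ℚ(ζ₇)` by residues**: a set `S ⊆ (ℤ/7)ˣ` of representatives of
`(ℤ/7)ˣ/{±1}` (a CM type) whose translates `u·S` SEPARATE the units (primitivity in Kubota's form, Shimura §8.2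
Prop. 26: `H₁ = H'`) is one of the six sets `prim7 i`, and conversely — the two remaining CM residue sets are the
cosets `{1,2,4}`, `{3,5,6}` of the subgroup of squares.  (Decided over the `2⁶` subsets of the units.)
[cite: Shimura1998, §8.2 Prop. 26] -/
theorem separating_iff_mem_prim7 : ∀ S ∈ units7.powerset, (∀ c ∈ units7, (c ∈ S ↔ -c ∉ S)) →
    ((∀ a ∈ units7, ∀ b ∈ units7, (∀ u ∈ units7, (u * a ∈ S ↔ u * b ∈ S)) → a = b) ↔ ∃ i : Fin 6, prim7 i = S) := by
  decide

set_option maxRecDepth 8192 in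
set_option synthInstance.maxSize 2048 in
set_option synthInstance.maxHeartbeats 200000 in
/-- **The two IMPRIMITIVE CM residue sets** of `(ℤ/7)ˣ`: a CM residue set whose translates do NOT separate the units is
`{1,2,4}` or `{3,5,6}` (the cosets of the subgroup of squares; the types induced from `ℚ(√-7)`).
[cite: Shimura1998, §8.2 Prop. 26] -/
theorem eq_squares_or_of_not_separating : ∀ S ∈ units7.powerset, (∀ c ∈ units7, (c ∈ S ↔ -c ∉ S)) →
    (¬ ∀ a ∈ units7, ∀ b ∈ units7, (∀ u ∈ units7, (u * a ∈ S ↔ u * b ∈ S)) → a = b) →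
      S = {1, 2, 4} ∨ S = {3, 5, 6} := by
  decide

/-- `prim7` lists translates of `{1,2,3}`: ONE `Aut(ℂ)`-orbit of CM types. [cite: Shimura1998, §8.2 Prop. 26] -/
theorem prim7_eq_translate :
    ∀ i : Fin 6, ∃ a ∈ units7, prim7 i = units7.filter fun c => a * c ∈ ({1, 2, 3} : Finset (ZMod 7)) := by
  decide

/-- `prim7` is injective (the six sets are distinct). [folklore] -/
theorem prim7_injective : Function.Injective prim7 := by decide

/-- **Conjugate pairs**: `prim7 (5 − i) = −prim7 i = {c | −c ∈ prim7 i}` on the units. [folklore] -/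
theorem prim7_conj6 : ∀ i : Fin 6, prim7 (conj6 i) = units7.filter fun c => -c ∈ prim7 i := by decide

/-- **The three column relations force conjugation symmetry.**  If `n : Fin 6 → ℕ` (multiplicities of the six
primitive types in a family) has CONSTANT incidence sums `Σ_{i : c ∈ prim7 i} n i` over the units `c`, then
`n 0 = n 5`, `n 1 = n 4`, `n 2 = n 3` — from `(col 1) − (col 3)`, `(col 2) − (col 3)`, `(col 1) − (col 5)`.  This is
the combinatorial content of "over `ℚ(ζ₇)`, a constant-sum family of primitive types is a union of conjugate pairs"
(Deligne's Lemma 5.2 families). [cite: Deligne1982HodgeCycles, I §5 (c) and Lemma 5.2 (pp. 38–40)] -/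
theorem primitive_colsum_symmetric (n : Fin 6 → ℕ)
    (h : ∀ c ∈ units7, ∀ c' ∈ units7,
      ∑ i ∈ Finset.univ.filter (fun i => c ∈ prim7 i), n i = ∑ i ∈ Finset.univ.filter (fun i => c' ∈ prim7 i), n i) :
    n 0 = n 5 ∧ n 1 = n 4 ∧ n 2 = n 3 := by
  have e1 : (Finset.univ.filter fun i : Fin 6 => (1 : ZMod 7) ∈ prim7 i) = {0, 3, 4} := by decide
  have e2 : (Finset.univ.filter fun i : Fin 6 => (2 : ZMod 7) ∈ prim7 i) = {0, 1, 2} := by decide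
  have e3 : (Finset.univ.filter fun i : Fin 6 => (3 : ZMod 7) ∈ prim7 i) = {0, 2, 4} := by decide
  have e5 : (Finset.univ.filter fun i : Fin 6 => (5 : ZMod 7) ∈ prim7 i) = {3, 4, 5} := by decide
  have s3 : ∀ a b c : Fin 6, a ≠ b → a ≠ c → b ≠ c →
      ∑ i ∈ ({a, b, c} : Finset (Fin 6)), n i = n a + n b + n c := by
    intro a b c hab hac hbc
    rw [Finset.sum_insert (by simp [hab, hac]), Finset.sum_pair hbc, add_assoc]
  have h13 := h 1 (by decide) 3 (by decide)
  rw [e1, e3, s3 0 3 4 (by decide) (by decide) (by decide), s3 0 2 4 (by decide) (by decide) (by decide)] at h13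
  have h23 := h 2 (by decide) 3 (by decide)
  rw [e2, e3, s3 0 1 2 (by decide) (by decide) (by decide), s3 0 2 4 (by decide) (by decide) (by decide)] at h23
  have h15 := h 1 (by decide) 5 (by decide)
  rw [e1, e5, s3 0 3 4 (by decide) (by decide) (by decide), s3 3 4 5 (by decide) (by decide) (by decide)] at h15
  omega

/-- The same symmetry against the involution `conj6`: `n i = n (5 − i)` for all `i`.
[cite: Deligne1982HodgeCycles, I §5 (c) and Lemma 5.2 (pp. 38–40)] -/
theorem primitive_colsum_symmetric' (n : Fin 6 → ℕ)
    (h : ∀ c ∈ units7, ∀ c' ∈ units7,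
      ∑ i ∈ Finset.univ.filter (fun i => c ∈ prim7 i), n i = ∑ i ∈ Finset.univ.filter (fun i => c' ∈ prim7 i), n i)
    (i : Fin 6) : n i = n (conj6 i) := by
  obtain ⟨h05, h14, h23⟩ := primitive_colsum_symmetric n h
  fin_cases i
  exacts [h05, h14, h23, h23.symm, h14.symm, h05.symm]

/-- Counting a decidable subset of `Fin n` with `Set.ncard`. [folklore] -/
theorem ncard_setOf_fin_eq_card_filter {n : ℕ} (p : Fin n → Prop) [DecidablePred p] :
    {j : Fin n | p j}.ncard = (Finset.univ.filter p).card := by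
  rw [← Set.ncard_coe_finset, Finset.coe_filter]
  simp only [Finset.mem_univ, true_and]

end Residues

/-! ### §2 The residue set of a CM type of `ℚ(ζ₇)`; primitive types have residue set in `prim7` -/

section ResSet

variable (L : Type) [Field L] [NumberField L] [IsCyclotomicExtension {7} ℚ L]

open scoped Classical in
/-- **The residue set `resSet Φ ⊆ (ℤ/7)ˣ` of a CM type `Φ` of `ℚ(ζ₇)`**: the exponents `e(σ)` of its members
(`σ ζ₇ = e^{2πi e(σ)/7}`), i.e. `Φ = {σ_c | c ∈ resSet Φ}` under `Hom(ℚ(ζ₇), ℂ) ≅ (ℤ/7)ˣ`. [cite: Washington1997, Thm. 2.5] -/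
def resSet (Φ : CMType L) : Finset (ZMod 7) := units7.filter fun c => ∃ σ : L →+* ℂ, σ ∈ Φ.1 ∧ expOf 7 L σ = c

/-- `resSet Φ ⊆ (ℤ/7)ˣ`. [cite: Washington1997, Thm. 2.5] -/
theorem resSet_subset (Φ : CMType L) : resSet L Φ ⊆ units7 := by
  classical
  exact Finset.filter_subset _ _

/-- **Membership is read on the exponent**: `e(σ) ∈ resSet Φ ↔ σ ∈ Φ` (`σ ↦ e(σ)` is injective).
[cite: Washington1997, Thm. 2.5] -/
theorem mem_resSet_iff (Φ : CMType L) (σ : L →+* ℂ) : expOf 7 L σ ∈ resSet L Φ ↔ σ ∈ Φ.1 := by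
  classical
  rw [resSet, Finset.mem_filter]
  constructor
  · rintro ⟨-, τ, hτ, hτσ⟩
    rwa [← expOf_injective 7 L hτσ]
  · intro h
    exact ⟨(coprime_seven_iff_mem_units7 _).1 (coprime_expOf 7 L σ), σ, h, rfl⟩

/-- `resSet Φ` is a set of representatives of `(ℤ/7)ˣ/{±1}` (`e(σ̄) = −e(σ)` and `Φ` is a CM type).
[cite: Washington1997, Thm. 2.5] -/
theorem resSet_cm (Φ : CMType L) : ∀ c ∈ units7, c ∈ resSet L Φ ↔ -c ∉ resSet L Φ := by
  intro c hc
  obtain ⟨σ, rfl⟩ := exists_expOf_eq 7 L c ((coprime_seven_iff_mem_units7 c).2 hc)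
  rw [mem_resSet_iff, ← expOf_conjugate, mem_resSet_iff]
  exact Φ.2 σ

/-- Two CM types of `ℚ(ζ₇)` coincide iff their residue sets do. [cite: Washington1997, Thm. 2.5] -/
theorem carrier_eq_iff_resSet_eq (Φ Ψ : CMType L) : Φ.1 = Ψ.1 ↔ resSet L Φ = resSet L Ψ := by
  constructor
  · intro h
    ext c
    constructor
    · intro hc
      obtain ⟨σ, rfl⟩ := exists_expOf_eq 7 L c ((coprime_seven_iff_mem_units7 c).2 (resSet_subset L Φ hc))
      rw [mem_resSet_iff] at hc ⊢
      rwa [← h]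
    · intro hc
      obtain ⟨σ, rfl⟩ := exists_expOf_eq 7 L c ((coprime_seven_iff_mem_units7 c).2 (resSet_subset L Ψ hc))
      rw [mem_resSet_iff] at hc ⊢
      rwa [h]
  · intro h
    ext σ
    rw [← mem_resSet_iff, h, mem_resSet_iff]

/-- A CM type is the CONJUGATE of another (its set of embeddings is the complement) iff its residue set is the
negative: `Φ = Ψ̄ ↔ resSet Φ = −resSet Ψ`. [cite: Washington1997, Thm. 2.5] -/
theorem carrier_eq_compl_iff_resSet_eq (Φ Ψ : CMType L) :
    Φ.1 = (Ψ.1)ᶜ ↔ resSet L Φ = units7.filter fun c => -c ∈ resSet L Ψ := by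
  constructor
  · intro h
    ext c
    rw [Finset.mem_filter]
    constructor
    · intro hc
      have hcu : c ∈ units7 := resSet_subset L Φ hc
      obtain ⟨σ, rfl⟩ := exists_expOf_eq 7 L c ((coprime_seven_iff_mem_units7 c).2 hcu)
      refine ⟨hcu, ?_⟩
      rw [mem_resSet_iff, h, Set.mem_compl_iff, ← mem_resSet_iff L Ψ] at hc
      by_contra hneg
      exact ((resSet_cm L Ψ _ hcu).not.1 hc) (fun h' => hneg (by simpa using h'))
    · rintro ⟨hcu, hneg⟩
      obtain ⟨σ, rfl⟩ := exists_expOf_eq 7 L c ((coprime_seven_iff_mem_units7 c).2 hcu)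
      rw [mem_resSet_iff, h, Set.mem_compl_iff, ← mem_resSet_iff L Ψ]
      exact fun hc => (resSet_cm L Ψ _ hcu).1 hc hneg
  · intro h
    ext σ
    have hcu : expOf 7 L σ ∈ units7 := (coprime_seven_iff_mem_units7 _).1 (coprime_expOf 7 L σ)
    rw [← mem_resSet_iff, h, Finset.mem_filter, Set.mem_compl_iff, ← mem_resSet_iff L Ψ]
    constructor
    · rintro ⟨-, hneg⟩ hc
      exact (resSet_cm L Ψ _ hcu).1 hc hneg
    · intro hc
      refine ⟨hcu, ?_⟩
      by_contra hneg
      exact hc (by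
        have := (resSet_cm L Ψ (-expOf 7 L σ) ?_)
        · rw [neg_neg] at this
          exact not_not.1 fun hc' => hneg (this.2 hc')
        · exact (coprime_seven_iff_mem_units7 _).1 (by
            rw [← expOf_conjugate]; exact coprime_expOf 7 L _))

/-- **Primitivity ⟺ the translates of the residue set separate the units**: `(Φ, φ₀)` is primitive
(`IsPrimitive`, Shimura §8.2 Prop. 26 over `Aut(ℂ)`; Kubota: embeddings with the same pattern `τ ↦ [τ ∘ σ ∈ Φ]`
coincide, `isPrimitive_iff_forall_eq`) iff units `a, b` with `u·a ∈ resSet Φ ↔ u·b ∈ resSet Φ` for all units `u` are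
equal — every unit is the cyclotomic character `autExp τ` of an automorphism `τ` of `ℂ` (`exists_autExp_eq`), and
`e(τ ∘ σ) = autExp τ · e(σ)`. [cite: Shimura1998, §8.2 Prop. 26] [cite: Washington1997, Thm. 2.5] -/
theorem isPrimitive_iff_resSet_separating (Φ : CMType L) (φ₀ : L →+* ℂ) :
    IsPrimitive (ℂ ≃+* ℂ) Φ.1 φ₀ ↔
      ∀ a ∈ units7, ∀ b ∈ units7, (∀ u ∈ units7, (u * a ∈ resSet L Φ ↔ u * b ∈ resSet L Φ)) → a = b := by
  haveI := Literature.AlgebraicGeometry.Pohlmann1968.isPretransitive_ringEquiv_complex (K := L)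
  rw [isPrimitive_iff_forall_eq Φ.1 φ₀]
  constructor
  · intro hP a ha b hb hab
    obtain ⟨σ, rfl⟩ := exists_expOf_eq 7 L a ((coprime_seven_iff_mem_units7 a).2 ha)
    obtain ⟨σ', rfl⟩ := exists_expOf_eq 7 L b ((coprime_seven_iff_mem_units7 b).2 hb)
    have hσσ' : σ = σ' := by
      refine hP σ σ' fun τ => ?_
      have hu : autExp 7 τ ∈ units7 := (coprime_seven_iff_mem_units7 _).1 (coprime_autExp 7 τ)
      show (τ : ℂ →+* ℂ).comp σ ∈ Φ.1 ↔ (τ : ℂ →+* ℂ).comp σ' ∈ Φ.1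
      rw [← mem_resSet_iff L Φ ((τ : ℂ →+* ℂ).comp σ), ← mem_resSet_iff L Φ ((τ : ℂ →+* ℂ).comp σ'),
        expOf_comp, expOf_comp]
      exact hab _ hu
    rw [hσσ']
  · intro hsep σ σ' hpat
    apply expOf_injective 7 L
    refine hsep _ ((coprime_seven_iff_mem_units7 _).1 (coprime_expOf 7 L σ)) _
      ((coprime_seven_iff_mem_units7 _).1 (coprime_expOf 7 L σ')) fun u hu => ?_
    obtain ⟨τ, hτ⟩ := exists_autExp_eq 7 u ((coprime_seven_iff_mem_units7 u).2 hu)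
    have h := hpat τ
    change (τ : ℂ →+* ℂ).comp σ ∈ Φ.1 ↔ (τ : ℂ →+* ℂ).comp σ' ∈ Φ.1 at h
    rw [← mem_resSet_iff L Φ ((τ : ℂ →+* ℂ).comp σ), ← mem_resSet_iff L Φ ((τ : ℂ →+* ℂ).comp σ'),
      expOf_comp, expOf_comp, hτ] at h
    exact h

/-- Primitivity ⟹ the translates of the residue set separate the units. [cite: Shimura1998, §8.2 Prop. 26] -/
theorem resSet_separating_of_isPrimitive (Φ : CMType L) (φ₀ : L →+* ℂ) (hP : IsPrimitive (ℂ ≃+* ℂ) Φ.1 φ₀) :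
    ∀ a ∈ units7, ∀ b ∈ units7, (∀ u ∈ units7, (u * a ∈ resSet L Φ ↔ u * b ∈ resSet L Φ)) → a = b :=
  (isPrimitive_iff_resSet_separating L Φ φ₀).1 hP

/-- **A primitive CM type of `ℚ(ζ₇)` has residue set `prim7 i` for some `i`.** [cite: Shimura1998, §8.2 Prop. 26] -/
theorem exists_prim7_eq_resSet_of_isPrimitive (Φ : CMType L) (φ₀ : L →+* ℂ)
    (hP : IsPrimitive (ℂ ≃+* ℂ) Φ.1 φ₀) : ∃ i : Fin 6, prim7 i = resSet L Φ :=
  (separating_iff_mem_prim7 _ (Finset.mem_powerset.2 (resSet_subset L Φ)) (resSet_cm L Φ)).1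
    (resSet_separating_of_isPrimitive L Φ φ₀ hP)

/-- **Simplicity of a realisation ⟹ residue set in `prim7`** (Shimura §8.2 Prop. 26: a CM abelian variety is simple
iff its type is primitive, tree theorem `isSimple_iff_isPrimitive`). [cite: Shimura1998, §8.2 Prop. 26] -/
theorem exists_prim7_eq_resSet_of_isSimple (Φ : CMType L) {A : AbelianVariety ℂ} {ι : 𝓞 L →+* End A}
    {θ : L →+* Module.End ℂ (complexBetti A.X 1)} (hA : IsCMTypeRealisation Φ A ι θ) (hS : A.IsSimple) :
    ∃ i : Fin 6, prim7 i = resSet L Φ := by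
  obtain ⟨s₀⟩ := (inferInstance : Nonempty (L →+* ℂ))
  exact exists_prim7_eq_resSet_of_isPrimitive L Φ s₀ ((isSimple_iff_isPrimitive hA s₀).1 hS)

/-- **A NON-simple realisation of a CM type of `ℚ(ζ₇)` has residue set `{1,2,4}` or `{3,5,6}`** — its type is
induced from `ℚ(√-7)` and `A ~ E³` for an elliptic curve `E` with CM by `ℚ(√-7)` (Shimura §8.2 Prop. 26 with §6.2
Thm. 3). [cite: Shimura1998, §8.2 Prop. 26 and §6.2 Thm. 3] -/
theorem resSet_eq_squares_or_of_not_isSimple (Φ : CMType L) {A : AbelianVariety ℂ} {ι : 𝓞 L →+* End A}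
    {θ : L →+* Module.End ℂ (complexBetti A.X 1)} (hA : IsCMTypeRealisation Φ A ι θ) (hS : ¬ A.IsSimple) :
    resSet L Φ = {1, 2, 4} ∨ resSet L Φ = {3, 5, 6} := by
  obtain ⟨s₀⟩ := (inferInstance : Nonempty (L →+* ℂ))
  refine eq_squares_or_of_not_separating _ (Finset.mem_powerset.2 (resSet_subset L Φ)) (resSet_cm L Φ) fun hsep => ?_
  exact hS ((isSimple_iff_isPrimitive hA s₀).2 ((isPrimitive_iff_resSet_separating L Φ s₀).2 hsep))

end ResSet

end Summit.HodgeConjecture.CorCM.Zeta7WeilFamily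

end
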